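import Summits.CriticalPhenomena.SAWScalingLimit.Theorems.SAWLoopFugacityFlowSimpleSubseqLimitsStubPassage
import Summits.CriticalPhenomena.SAWScalingLimit.Theorems.SimpleSubseqLimits.Negative.SimpleSubseqLimitsCore
import Summits.CriticalPhenomena.SAWScalingLimit.Theorems.SAWLoopFugacityFlowSimpleSubseqLimitsFirstHitFlat
import HarnessLib

/-!
# First-hit typing of the ORDER residual of the crux `SimpleSubseqLimits` — limit passage and closing
(crux stmt-CriticalPhenomena-4982, decl `Summit.CriticalPhenomena.SAWScalingLimit.Theses.SAWLoopFugacityFlow.SimpleSubseqLimits`;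
line lead c2, 2026-08-16)

The third typing of the crux's single open lattice input (after the kiss typing `NoTouchAt` of line
`marked-point-revisit` v1 and the shadow typing `ShadowDecay` of v2 / `past-shadowing-costs-halves`):
**first-hit return decay** `FirstHitDecayAt D a b` — for every closed ball `B̄(q, r)`, separation `ρ`
and target `θ` there are a return width `ε > 0` and an outer radius `r' > r` such that, for all small
meshes, with probability `≤ θ` the critical SAW polyline has times `v < T ≤ t'` with: it stayed `r`-away
from `q` up to `v` (so `v` precedes the first `r`-approach of `q`), it is `r'`-close to `q` at `T`,
`γ v` is `ρ`-far from `γ T`, and at `t'` it comes back `ε`-close to `γ v`.  This is the lattice form of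
LSW's heuristic "the rest of the SAW avoids its past as it avoids the boundary" (LSW04 §3.4.5) at the
stopping time "first entrance into `B̄(q, r)`", where the exact domain Markov property makes the future a
critical SAW of the slit graph.

Results (namespace `…Theorems.SimpleSubseqLimits.FirstHit.Passage`):
* `firstHitReturnEvent_subset_near` — an exact first-hit return is an `ε`-near one for all `r' > r`, `ε > 0`;
* `isOpen_setOf_nearFirstHitReturn`, `isOpen_nearFirstHitReturnEvent` — the thickened event is OPEN
  (strict inequalities; the universal clause ranges over the compact `[0, v]`; reparametrisation transport);
* `firstHitReturn_null` — LIMIT PASSAGE: `FirstHitDecayAt D a b` + weak convergence along `s n → 0⁺`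
  ⇒ `ν (firstHitReturnEvent q r ρ) = 0` for all `q`, `0 < r`, `0 < ρ` (open-set portmanteau,
  `Passage.measure_image_mk_le_limsup_law`);
* `mem_simple_of_forall_notMem_firstHitReturnEvent` — CLOSING: a class with distinct endpoints outside
  the countably many exact events (rational data) is SIMPLE — by the landed Rohde–Schramm-one-level-down
  lemma `FirstHitFlat.mk_mem_simple_of_firstHit_closedBall` (p129562); NO SHAPE INPUT is used;
* `ae_simple_of_firstHitDecayAt` — hence every subsequential weak limit along an endpoint approximation
  with first-hit decay is carried by simple classes (endpoints are free: `a ≠ b`).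
The boundary clause of the crux still needs SHAPE (the A-side); the composition is
`Theorems/SAWLoopFugacityFlowSimpleSubseqLimitsFirstHitLine.lean`.
-/

noncomputable section

open MeasureTheory Filter Topology Set Metric Function
open Literature.Probability.RandomPlanarGeometry Literature.Probability.LatticeModels
open scoped ENNReal NNReal BoundedContinuousFunction unitInterval

namespace Summit.CriticalPhenomena.SAWScalingLimit.Theorems.SimpleSubseqLimits.FirstHit.Passage

open Summit.CriticalPhenomena.SAWScalingLimit.Theorems.SimpleSubseqLimits.Negative
  (WeakLimitAlong ae_source_target_range_of_weakLimitAlong)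
open Summit.CriticalPhenomena.SAWScalingLimit.Theorems.SimpleSubseqLimits.MarkedPointRevisit.Passage
  (latticeCurve mk_mem_image_mk_iff measure_image_mk_le_limsup_law IsSubseqLimit)
open Summit.CriticalPhenomena.SAWScalingLimit.Theorems.SimpleSubseqLimits.FirstHitFlat
  (mk_mem_simple_of_firstHit_closedBall)

/-! ### Vocabulary -/

/-- **Exact first-hit return** of a curve at the closed ball `B̄(q, r)` with separation `ρ`: times
`v < T ≤ t'` such that `T` is the FIRST hitting time of `B̄(q, r)`, the past value `γ v` is `ρ`-far from
the entrance point `γ T`, and the curve returns to it exactly at `t'` (`γ t' = γ v`). A flat curve has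
none; a Z-fold or a kiss has one for suitable rational data. [folklore] -/
def FirstHitReturn (γ : Curve ℂ) (q : ℂ) (r ρ : ℝ) : Prop :=
  ∃ v T t' : I, v < T ∧ T ≤ t' ∧ γ T ∈ closedBall q r ∧ (∀ u : I, u < T → γ u ∉ closedBall q r) ∧
    ρ < dist (γ v) (γ T) ∧ γ t' = γ v

/-- The event "some representative has an exact first-hit return at `(q, r, ρ)`". [folklore] -/
def firstHitReturnEvent (q : ℂ) (r ρ : ℝ) : Set (CurveClass ℂ) :=
  {c | ∃ γ : Curve ℂ, CurveClass.mk γ = c ∧ FirstHitReturn γ q r ρ}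

/-- **Thickened (open) first-hit return**: times `v < T ≤ t'` with the curve `r`-far from `q` on
`[0, v]` (so `v` precedes the first `r`-approach of `q`), `r'`-close to `q` at `T`, `γ v` `ρ`-far from
`γ T`, and `γ t'` `ε`-close to `γ v`. All inequalities strict, the universal clause over the compact
`[0, v]`: an OPEN, reparametrisation-invariant condition, visible on the lattice polyline. [folklore] -/
def NearFirstHitReturn (γ : Curve ℂ) (q : ℂ) (r r' ρ ε : ℝ) : Prop :=
  ∃ v T t' : I, v < T ∧ T ≤ t' ∧ (∀ u : I, u ≤ v → r < dist (γ u) q) ∧ dist (γ T) q < r' ∧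
    ρ < dist (γ v) (γ T) ∧ dist (γ t') (γ v) < ε

/-- The event "some representative has an `ε`-near first-hit return at `(q, r, r', ρ)`". [folklore] -/
def nearFirstHitReturnEvent (q : ℂ) (r r' ρ ε : ℝ) : Set (CurveClass ℂ) :=
  {c | ∃ γ : Curve ℂ, CurveClass.mk γ = c ∧ NearFirstHitReturn γ q r r' ρ ε}

/-- **First-hit return decay at `(D; a_δ, b_δ)`** (the first-hit typing of the crux's ORDER input):
for every centre `q`, radius `r > 0`, separation `ρ > 0` and target `θ > 0` there are a return width
`ε > 0` and an outer radius `r' > r` such that for all small meshes the critical SAW law charges the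
thickened first-hit return event at most `θ`. An unconditional probability of an OPEN event of the
curve class of the walk; an `x_c`-statement (false for `x > x_c`: space-filling limits return to their
past); implied by the summit conjecture and necessary for the crux given `EventualTight`
(`FirstHit.Pinned`). Lattice mechanism it asks for: conditionally on the walk up to its first vertex in
`B̄(q, r)` the remainder is the critical SAW of the slit graph `Ω_δ ∖ γ[0, T)` (exact domain Markov),
and the bound says that this remainder does not come back `ε`-close to the slit away from its tip —
boundary avoidance of the critical SAW in slit domains, uniformly over the slits. [folklore] -/
def FirstHitDecayAt (D : DobrushinDomain) (a b : ℝ → Site 2) : Prop :=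
  ∀ (q : ℂ) (r ρ θ : ℝ), 0 < r → 0 < ρ → 0 < θ → ∃ ε r' : ℝ, 0 < ε ∧ r < r' ∧
    ∀ᶠ δ in 𝓝[>] (0 : ℝ),
      SAW.law D.carrier δ (a δ) (b δ) {γ | γ.curve ∈ nearFirstHitReturnEvent q r r' ρ ε} ≤
        ENNReal.ofReal θ

/-- First-hit return decay along EVERY endpoint approximation (an open statement of this crux, the
first-hit typing of its ORDER input — deliberately untagged: it is not a literature fact). -/
def FirstHitDecay : Prop :=
  ∀ (D : DobrushinDomain) (a b : ℝ → Site 2), SAW.IsEndpointApprox D a b → FirstHitDecayAt D a b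

/-! ### Step 1: exact returns are near returns -/

/-- An exact first-hit return at `(q, r, ρ)` is an `ε`-near one at `(q, r, r', ρ)` for all `r' > r`,
`ε > 0` (same witnessing times: before `v < T` the curve is outside `B̄(q, r)`). [folklore] -/
theorem nearFirstHitReturn_of_firstHitReturn {γ : Curve ℂ} {q : ℂ} {r r' ρ ε : ℝ} (hr : r < r')
    (hε : 0 < ε) (h : FirstHitReturn γ q r ρ) : NearFirstHitReturn γ q r r' ρ ε := by
  obtain ⟨v, T, t', hvT, hTt, hT, hfirst, hρ, hret⟩ := h
  refine ⟨v, T, t', hvT, hTt, fun u hu => ?_, ?_, hρ, ?_⟩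
  · have h := hfirst u (lt_of_le_of_lt hu hvT)
    rw [mem_closedBall, not_le] at h
    exact h
  · rw [mem_closedBall] at hT
    exact hT.trans_lt hr
  · rw [hret, dist_self]
    exact hε

/-- `firstHitReturnEvent q r ρ ⊆ nearFirstHitReturnEvent q r r' ρ ε` for `r < r'`, `0 < ε`. [folklore] -/
theorem firstHitReturnEvent_subset_near {q : ℂ} {r r' ρ ε : ℝ} (hr : r < r') (hε : 0 < ε) :
    firstHitReturnEvent q r ρ ⊆ nearFirstHitReturnEvent q r r' ρ ε :=
  fun _ ⟨γ, hγ, h⟩ => ⟨γ, hγ, nearFirstHitReturn_of_firstHitReturn hr hε h⟩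

/-! ### Step 2: the thickened configuration is open -/

/-- **Openness of the thickened first-hit return configuration** for the reparametrisation
pseudo-distance on `Curve ℂ`: fix witnessing times `v < T ≤ t'` for `γ`; the three pointwise clauses
have positive slacks and the universal clause a uniform one on the compact `[0, v]`
(`IsCompact.exists_isMinOn`); a curve `γ'` at distance below half the least slack has a
reparametrisation `φ` with `γ' ∘ φ` uniformly that close to `γ` (`Curve.exists_dist_reparam_lt`), and
`(φ v, φ T, φ t')` witnesses the configuration for `γ'`. [folklore] -/
theorem isOpen_setOf_nearFirstHitReturn (q : ℂ) (r r' ρ ε : ℝ) :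
    IsOpen {γ : Curve ℂ | NearFirstHitReturn γ q r r' ρ ε} := by
  rw [Metric.isOpen_iff]
  rintro γ ⟨v, T, t', hvT, hTt, hpast, hT, hρ, hret⟩
  -- uniform slack of the universal clause on the compact `[0, v]`
  obtain ⟨m, hm⟩ : ∃ m : ℝ, r < m ∧ ∀ u : I, u ≤ v → m ≤ dist (γ u) q := by
    have hK : IsCompact (Iic v) := isClosed_Iic.isCompact
    have hc : ContinuousOn (fun u : I => dist (γ u) q) (Iic v) :=
      (γ.continuous.dist continuous_const).continuousOn
    obtain ⟨u₀, hu₀, hmin⟩ := hK.exists_isMinOn nonempty_Iic hc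
    exact ⟨dist (γ u₀) q, hpast u₀ hu₀, fun u hu => hmin hu⟩
  obtain ⟨hrm, hmin⟩ := hm
  -- one positive margin `d` below half of every slack
  obtain ⟨d, hd0, hd1, hd2, hd3, hd4⟩ : ∃ d : ℝ, 0 < d ∧ 2 * d ≤ m - r ∧ 2 * d ≤ r' - dist (γ T) q ∧
      2 * d ≤ dist (γ v) (γ T) - ρ ∧ 2 * d ≤ ε - dist (γ t') (γ v) := by
    refine ⟨min (min (m - r) (r' - dist (γ T) q)) (min (dist (γ v) (γ T) - ρ) (ε - dist (γ t') (γ v))) / 2,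
      half_pos (lt_min (lt_min (sub_pos.2 hrm) (sub_pos.2 hT)) (lt_min (sub_pos.2 hρ) (sub_pos.2 hret))),
      ?_, ?_, ?_, ?_⟩
    · linarith [min_le_left (min (m - r) (r' - dist (γ T) q)) (min (dist (γ v) (γ T) - ρ) (ε - dist (γ t') (γ v))),
        min_le_left (m - r) (r' - dist (γ T) q)]
    · linarith [min_le_left (min (m - r) (r' - dist (γ T) q)) (min (dist (γ v) (γ T) - ρ) (ε - dist (γ t') (γ v))),
        min_le_right (m - r) (r' - dist (γ T) q)]
    · linarith [min_le_right (min (m - r) (r' - dist (γ T) q)) (min (dist (γ v) (γ T) - ρ) (ε - dist (γ t') (γ v))),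
        min_le_left (dist (γ v) (γ T) - ρ) (ε - dist (γ t') (γ v))]
    · linarith [min_le_right (min (m - r) (r' - dist (γ T) q)) (min (dist (γ v) (γ T) - ρ) (ε - dist (γ t') (γ v))),
        min_le_right (dist (γ v) (γ T) - ρ) (ε - dist (γ t') (γ v))]
  refine ⟨d, hd0, fun γ' hγ' => ?_⟩
  rw [Metric.mem_ball, dist_comm] at hγ'
  obtain ⟨φ, hφ⟩ := Curve.exists_dist_reparam_lt hγ'
  have hcl : ∀ u, dist (γ u) (γ' (φ u)) < d := fun u => by
    have h := ContinuousMap.dist_apply_le_dist (f := γ.toContinuousMap)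
      (g := (γ'.reparam φ).toContinuousMap) (x := u)
    simp only [Curve.coe_toContinuousMap, Curve.reparam_apply] at h
    exact h.trans_lt hφ
  have hcl' : ∀ u', dist (γ (φ.symm u')) (γ' u') < d := fun u' => by
    simpa only [OrderIso.apply_symm_apply] using hcl (φ.symm u')
  refine ⟨φ v, φ T, φ t', φ.lt_iff_lt.2 hvT, φ.le_iff_le.2 hTt, ?_, ?_, ?_, ?_⟩
  · intro u' hu'
    have hle : φ.symm u' ≤ v := φ.symm_apply_le.2 hu'
    have h₁ := hmin (φ.symm u') hle
    have h₂ := dist_triangle (γ (φ.symm u')) (γ' u') q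
    have h₃ := hcl' u'
    linarith
  · have h₁ := dist_triangle (γ' (φ T)) (γ T) q
    have h₂ := hcl T
    rw [dist_comm] at h₂
    linarith
  · have h₁ := dist_triangle (γ v) (γ' (φ v)) (γ T)
    have h₂ := dist_triangle (γ' (φ v)) (γ' (φ T)) (γ T)
    have h₃ := hcl v
    have h₄ := hcl T
    rw [dist_comm] at h₄
    linarith
  · have h₁ := dist_triangle (γ' (φ t')) (γ t') (γ' (φ v))
    have h₂ := dist_triangle (γ t') (γ v) (γ' (φ v))
    have h₃ := hcl t'
    have h₄ := hcl v
    rw [dist_comm] at h₃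
    linarith

/-- The thickened event is the image of the open configuration set under the quotient map.
[folklore] -/
theorem nearFirstHitReturnEvent_eq_image (q : ℂ) (r r' ρ ε : ℝ) :
    nearFirstHitReturnEvent q r r' ρ ε = CurveClass.mk '' {γ | NearFirstHitReturn γ q r r' ρ ε} :=
  Set.ext fun _ => exists_congr fun _ => and_comm

/-- **The thickened first-hit return event is open** in `CurveClass ℂ` (`SeparationQuotient.mk` is an
open map). [folklore] -/
theorem isOpen_nearFirstHitReturnEvent (q : ℂ) (r r' ρ ε : ℝ) :
    IsOpen (nearFirstHitReturnEvent q r r' ρ ε) := by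
  rw [nearFirstHitReturnEvent_eq_image]
  exact SeparationQuotient.isOpenMap_mk _ (isOpen_setOf_nearFirstHitReturn q r r' ρ ε)

/-- The lattice event `{γ | γ.curve ∈ nearFirstHitReturnEvent …}` is the polyline event
`{γ | NearFirstHitReturn (latticeCurve γ) …}` (open sets of curves are saturated for distance zero).
[folklore] -/
theorem setOf_nearFirstHitReturn_latticeCurve {Ω : Set ℂ} {δ : ℝ} {u v : Site 2} (q : ℂ)
    (r r' ρ ε : ℝ) :
    {γ : SAW.DomainSAW Ω δ u v | NearFirstHitReturn (latticeCurve γ) q r r' ρ ε} =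
      {γ | γ.curve ∈ nearFirstHitReturnEvent q r r' ρ ε} := by
  ext γ
  simp only [mem_setOf_eq, nearFirstHitReturnEvent_eq_image]
  exact (mk_mem_image_mk_iff (isOpen_setOf_nearFirstHitReturn q r r' ρ ε) (latticeCurve γ)).symm

/-! ### Step 3: the limit passage -/

/-- **LIMIT PASSAGE.** First-hit return decay at `(D; a_δ, b_δ)` + weak convergence of the critical
SAW laws along `s n → 0⁺` to `ν` ⇒ `ν` gives mass `0` to every exact first-hit return event
(`0 < r`, `0 < ρ`): the exact event lies in the thickened one, which is the image of an OPEN set of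
curves, so the open-set portmanteau bound `ν(G) ≤ limsup_{δ → 0⁺} P_δ(G)`
(`Passage.measure_image_mk_le_limsup_law`) and the decay give `ν (firstHitReturnEvent q r ρ) ≤ θ` for
every `θ > 0`. [cite: BillingsleyCPM1999, Thm. 2.1] -/
theorem firstHitReturn_null {D : DobrushinDomain} {a b : ℝ → Site 2} {s : ℕ → ℝ}
    {ν : Measure (CurveClass ℂ)} (hFD : FirstHitDecayAt D a b) (hL : IsSubseqLimit D a b s ν)
    (q : ℂ) {r ρ : ℝ} (hr : 0 < r) (hρ : 0 < ρ) : ν (firstHitReturnEvent q r ρ) = 0 := by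
  obtain ⟨hs, hν, hw⟩ := hL
  haveI := hν
  have hθ : ∀ θ : ℝ, 0 < θ → ν (firstHitReturnEvent q r ρ) ≤ ENNReal.ofReal θ := by
    intro θ hθ
    obtain ⟨ε, r', hε, hr', hev⟩ := hFD q r ρ θ hr hρ hθ
    calc ν (firstHitReturnEvent q r ρ)
        ≤ ν (nearFirstHitReturnEvent q r r' ρ ε) :=
          measure_mono (firstHitReturnEvent_subset_near hr' hε)
      _ = ν (CurveClass.mk '' {γ | NearFirstHitReturn γ q r r' ρ ε}) := by
          rw [nearFirstHitReturnEvent_eq_image]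
      _ ≤ limsup (fun δ : ℝ => SAW.law D.carrier δ (a δ) (b δ)
            {γ | NearFirstHitReturn (latticeCurve γ) q r r' ρ ε}) (𝓝[>] (0 : ℝ)) :=
          measure_image_mk_le_limsup_law hs hw (isOpen_setOf_nearFirstHitReturn _ _ _ _ _)
      _ ≤ ENNReal.ofReal θ := by
          refine limsup_le_of_le (by isBoundedDefault) (hev.mono fun δ hδ => ?_)
          rwa [setOf_nearFirstHitReturn_latticeCurve]
  refine le_antisymm (ENNReal.le_of_forall_pos_le_add fun θ hθ' _ => ?_) zero_le
  rw [zero_add, ← ENNReal.ofReal_coe_nnreal]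
  exact hθ θ (NNReal.coe_pos.2 hθ')

/-! ### Step 4: the deterministic closing (Rohde–Schramm one level down, landed `FirstHitFlat`) -/

/-- The centres: Gaussian rationals `ℚ + iℚ`, a countable dense subset of `ℂ`. [folklore] -/
def gaussRat : Set ℂ := Set.range fun p : ℚ × ℚ => ((p.1 : ℝ) : ℂ) + ((p.2 : ℝ) : ℂ) * Complex.I

/-- `ℚ + iℚ` is countable. [folklore] -/
theorem countable_gaussRat : gaussRat.Countable := Set.countable_range _

/-- `ℚ + iℚ` is dense in `ℂ`. [folklore] -/
theorem dense_gaussRat : Dense gaussRat := by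
  intro z
  rw [Metric.mem_closure_iff]
  intro ε hε
  obtain ⟨p₁, hp₁⟩ := exists_rat_btwn (show z.re - ε / 2 < z.re by linarith)
  obtain ⟨p₂, hp₂⟩ := exists_rat_btwn (show z.im - ε / 2 < z.im by linarith)
  refine ⟨((p₁ : ℝ) : ℂ) + ((p₂ : ℝ) : ℂ) * Complex.I, ⟨(p₁, p₂), rfl⟩, ?_⟩
  rw [Complex.dist_eq]
  have hre : (z - (((p₁ : ℝ) : ℂ) + ((p₂ : ℝ) : ℂ) * Complex.I)).re = z.re - p₁ := by simp
  have him : (z - (((p₁ : ℝ) : ℂ) + ((p₂ : ℝ) : ℂ) * Complex.I)).im = z.im - p₂ := by simp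
  have h1 : |z.re - p₁| < ε / 2 := by rw [abs_lt]; constructor <;> linarith [hp₁.1, hp₁.2]
  have h2 : |z.im - p₂| < ε / 2 := by rw [abs_lt]; constructor <;> linarith [hp₂.1, hp₂.2]
  calc ‖z - (((p₁ : ℝ) : ℂ) + ((p₂ : ℝ) : ℂ) * Complex.I)‖
      ≤ |(z - (((p₁ : ℝ) : ℂ) + ((p₂ : ℝ) : ℂ) * Complex.I)).re| +
          |(z - (((p₁ : ℝ) : ℂ) + ((p₂ : ℝ) : ℂ) * Complex.I)).im| := Complex.norm_le_abs_re_add_abs_im _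
    _ < ε := by rw [hre, him]; linarith

/-- **CLOSING.** A class with distinct endpoints lying outside every exact first-hit return event with
Gaussian-rational centre and positive rational radius and separation is SIMPLE: any representative `γ`
then returns to no value taken strictly before the first hit of any such closed ball (an exact return
`γ u = γ v`, `v < T ≤ u`, has `γ v ≠ γ T`, hence a rational separation below `dist (γ v) (γ T)`), so
`FirstHitFlat.mk_mem_simple_of_firstHit_closedBall` applies. No SHAPE input. [cite: RohdeSchramm2005, Thm. 6.1] -/
theorem mem_simple_of_forall_notMem_firstHitReturnEvent (c : CurveClass ℂ)
    (h : ∀ q ∈ gaussRat, ∀ r ρ : ℚ, 0 < r → 0 < ρ → c ∉ firstHitReturnEvent q r ρ)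
    (h01 : c.source ≠ c.target) : c ∈ CurveClass.simple := by
  obtain ⟨γ, rfl⟩ := CurveClass.surjective_mk c
  refine mk_mem_simple_of_firstHit_closedBall γ dense_gaussRat ?_ h01
  intro q hq r hr T hT hfirst v u hvT hTu heq
  have hne : γ v ≠ γ T := fun h' => hfirst v hvT (h' ▸ hT)
  obtain ⟨ρ, hρ0, hρ⟩ := exists_rat_btwn (dist_pos.2 hne)
  have hρ0' : (0 : ℚ) < ρ := by exact_mod_cast hρ0
  exact h q hq r ρ hr hρ0' ⟨γ, rfl, v, T, u, hvT, hTu, hT, hfirst, hρ, heq⟩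

/-- **Every subsequential weak limit with first-hit decay is carried by SIMPLE classes** (the ORDER half
of the crux from the first-hit input alone): the countably many exact events are `ν`-null
(`firstHitReturn_null`), the endpoints `a ≠ b` are free (`Negative.ae_source_target_range_of_weakLimitAlong`,
`MarkedDomain.pt_injective`), and the closing lemma applies `ν`-a.e. [folklore] -/
theorem ae_simple_of_firstHitDecayAt {D : DobrushinDomain} {a b : ℝ → Site 2} {s : ℕ → ℝ}
    {ν : Measure (CurveClass ℂ)} (hab : SAW.IsEndpointApprox D a b) (hFD : FirstHitDecayAt D a b)
    (hL : IsSubseqLimit D a b s ν) : ∀ᵐ c ∂ν, c ∈ CurveClass.simple := by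
  haveI := hL.2.1
  have hfree := ae_source_target_range_of_weakLimitAlong (ν := ν) hab hL.1 hL.2.2
  haveI : Countable gaussRat := countable_gaussRat.to_subtype
  have hnull : ∀ᵐ c ∂ν, ∀ q : gaussRat, ∀ r ρ : {x : ℚ // 0 < x},
      c ∉ firstHitReturnEvent (q : ℂ) (r : ℚ) (ρ : ℚ) := by
    rw [ae_all_iff]; intro q
    rw [ae_all_iff]; intro r
    rw [ae_all_iff]; intro ρ
    have hr : (0 : ℝ) < ((r : ℚ) : ℝ) := by exact_mod_cast r.2
    have hρ : (0 : ℝ) < ((ρ : ℚ) : ℝ) := by exact_mod_cast ρ.2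
    exact measure_eq_zero_iff_ae_notMem.1 (firstHitReturn_null hFD hL q hr hρ)
  filter_upwards [hfree, hnull] with c hc hn
  refine mem_simple_of_forall_notMem_firstHitReturnEvent c (fun q hq r ρ hr hρ => ?_) ?_
  · exact hn ⟨q, hq⟩ ⟨r, hr⟩ ⟨ρ, hρ⟩
  · rw [hc.1, hc.2.1]
    exact fun h => absurd (D.pt_injective h) (by decide)

/-- **Registered form (stub `stub_firstHitPassage` of the crux item stmt-CriticalPhenomena-4982).**
Along every endpoint approximation, first-hit return decay at `(D; a_δ, b_δ)` forces every
subsequential weak limit of the critical SAW laws to be carried by SIMPLE classes — the ORDER half of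
the crux from the first-hit input alone (no SHAPE input). [folklore] -/
theorem stub_firstHitPassage : ∀ (D : DobrushinDomain) (a b : ℝ → Site 2) (s : ℕ → ℝ) (ν : Measure (CurveClass ℂ)), SAW.IsEndpointApprox D a b → FirstHitDecayAt D a b → IsSubseqLimit D a b s ν → ∀ᵐ c ∂ν, c ∈ CurveClass.simple :=
  fun _D _a _b _s _ν hab hFD hL => ae_simple_of_firstHitDecayAt hab hFD hL

end Summit.CriticalPhenomena.SAWScalingLimit.Theorems.SimpleSubseqLimits.FirstHit.Passage

end
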